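import Literature.Geometry.Lorentzian.AdiabaticTracking
import Summits.FinalStateConjecture.FinalStateConjecture.Statement
import HarnessLib

/-!
# ASSEMBLE packaging for crux `DriftCapture` (stmt-FinalStateConjecture-17391), line `birth`:
# a multi-hole final state decomposition from its `N + 1` late charts

The registered stub `stub_globalGaugePos` (ASSEMBLE on the live multi-hole range `0 < N`, `m₀ ≤ 1`) of
the skeleton `Summits/FinalStateConjecture/FinalStateConjecture/Cruxes/DriftCapture/Lines/birth.lean` asks,
for a maximal vacuum Cauchy development `𝒟` with complete `𝓘⁺` that is adiabatically tracked at every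
accuracy by chains of `ε`-approximate `N`-Kerr configurations pinned at one point `(M, a, Λ)` of the moduli
box, for a `C²` `FinalStateDecomposition d` of some `O'` with `d.N = N`, labels exactly `(M, a)`,
`O' = exteriorOf 𝒟 d.charted`, `HasExhaustiveCharts d` and `IsFutureOriented d`.

Its content splits into GLUING (research-level geometry: patch the pinned window charts into `N + 1`
horizon-normalised late charts — no tree API) and BOOKKEEPING (package `N + 1` late charts with the
right convergence, separation, covering and orientation clauses into the decomposition the Statement
consumes). This file lands the bookkeeping half, the multi-hole analogue of the `N = 0` packaging
`globalGauge_zero_of_flatLateChart` (`Theorems/RenormalisedDriftDriftCaptureStubGlobalGauge.lean`):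

* `decomposition_of_lateCharts` — for ANY Cauchy development `𝒟`, hole number `N`, labels
  `Mⱼ > 0`, `|aⱼ| ≤ Mⱼ`, and ANY late-chart data — a region `O'`, motions `(Λᵢ, cᵢ)`, a late time `τ₀`,
  hole charts `Ψᵢ` on the boosted Kerr exteriors, sublinear excision radii `ρᵢ`, a flat domain `U₀` with
  flat chart `Φ`, honest near-zone radii `Rᵢ(τ) ≥ max(r₊(Mᵢ, aᵢ), 0) + 1`, `Rᵢ → ∞` — such that `O'` is
  the exterior `J⁺(ι X) ∩ I⁻(·)` of the charted set `Φ{x⁰ > τ₀} ∪ ⋃ᵢ Ψᵢ{t*ᵢ > τ₀}`, all charts are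
  late charts into `O'`, the holes separate, the flat domain contains the late half-space minus the
  excised tubes, the `C²` deviations tend to `0` (from `η` on the flat slabs, from boosted Kerr on the
  truncated slabs out to `Rᵢ(τ)`), the CERTIFIED slabs cover `O'` causally at every chart time
  `τ₁ ≥ τ₀`, the motions are orthochronous and the pushed-forward background time vectors are
  eventually future-directed (the defining equation of `O'` and twelve further curried hypotheses: the
  clauses of `FinalStateDecomposition`, `HasExhaustiveCharts`, `IsFutureOriented` unfolded for this
  explicit data): THE SAME `O'` carries a
  `C²` `FinalStateDecomposition d` with `d.N = N`, labels `(M, a)` (definitionally),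
  `O' = exteriorOf 𝒟 d.charted`, `HasExhaustiveCharts d` and `IsFutureOriented d`.
  Two structure fields are DERIVED rather than assumed: near-zone convergence at every fixed radius
  (from convergence out to `Rᵢ(τ) → ∞`, by monotonicity of the truncated deviation in the radius) and
  the global covering clause at `τ₀` (the certified covering at `τ₁ = τ₀`, by monotonicity of `J⁻`).
* `globalGaugePos_of_lateCharts` — hence `stub_globalGaugePos` (verbatim, the conclusion) follows from
  the GLUING statement alone (the hypothesis: the stub's own binders and pinned-tracking hypothesis,
  concluding `∃ O' (Λᵢ, cᵢ) τ₀ Ψᵢ ρᵢ U₀ Φ Rᵢ, …` the conjunction of the thirteen clauses above for the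
  vacuum development), the labels' positivity and sub-extremality `|aⱼ| ≤ χ Mⱼ ≤ Mⱼ` coming from the
  moduli box (`0 < m₀ ≤ Mⱼ`, `χ < 1`). The GLUING statement is the natural sharper stub replacing
  `stub_globalGaugePos` in the skeleton.

What is NOT here: the gluing itself (window charts `Spacetime.IsWindowChart` of accuracies `εₖ ↓ 0`,
chained in time, labels pinned at `(M, a, Λ)` ⇒ one `Spacetime.IsLateChart` per background with
`truncDeviationCk → 0` out to growing radii, covering transfer, eventual future-direction).

No definitions are introduced and no named facts are used.

References: Dafermos–Holzegel–Rodnianski–Taylor arXiv:2104.08222, §1 (the `Cᵏ`-deviation vocabulary);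
Dafermos–Luk arXiv:1710.01722, Conjecture 1 (b)–(c) (shape of the exterior decomposition); Klainerman,
C. R. Mécanique 353 (2025), §1.1.1, §2.3; O'Neill 1983, Ch. 14, p. 403 (monotonicity of `J⁻`).
-/

-- the doubled `FinalStateConjecture.FinalStateConjecture` path component trips dupNamespace
set_option linter.dupNamespace false

noncomputable section

namespace Summit.FinalStateConjecture.FinalStateConjecture.Theorems.RenormalisedDrift.DriftCapture

open Set Filter Topology
open scoped Manifold ContDiff ENNReal
open Literature.Geometry.Lorentzian

/-- **Packaging `N + 1` late charts into an honest, exhaustive, future-oriented `N`-hole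
decomposition.** For any Cauchy development `𝒟`, labels `Mⱼ > 0`, `|aⱼ| ≤ Mⱼ` (`j < N`), and late-chart
data `(O', (Λᵢ, cᵢ), τ₀, Ψᵢ, ρᵢ, U₀, Φ, Rᵢ)` with: `O' = J⁺(ι X) ∩ I⁻(Φ{x⁰ > τ₀} ∪ ⋃ᵢ Ψᵢ{t*ᵢ > τ₀})`;
every `Ψᵢ` (on the boosted Kerr exterior `(Mᵢ, aᵢ, Λᵢ, cᵢ)`) and `Φ` (on `U₀`, background `η`) a late
chart into `O'` after `τ₀`; the truncated world-tubes eventually pairwise disjoint; `ρᵢ(t) = o(t)` and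
`U₀ ⊇ {x⁰ > τ₀, rᵢ(Λᵢ⁻¹(x − cᵢ)) > ρᵢ(x⁰) ∀ i}`; `C²` deviation from `η` on the flat slabs `→ 0`; honest
radii `Rᵢ(τ) ≥ max(r₊(Mᵢ, aᵢ), 0) + 1`, `Rᵢ → ∞`, with `C²` deviation from boosted Kerr on
`{t*ᵢ = τ, rᵢ ≤ Rᵢ(τ)}` `→ 0`; for every chart time `τ₁ ≥ τ₀` the part of `O'` outside
`Φ{x⁰ > τ₁} ∪ ⋃ᵢ Ψᵢ{t*ᵢ > τ₁, rᵢ ≤ Rᵢ(t*ᵢ)}` in the causal past of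
`Φ{x⁰ = τ₁} ∪ ⋃ᵢ Ψᵢ{t*ᵢ = τ₁, rᵢ ≤ Rᵢ(τ₁)}`; every `Λᵢ` orthochronous; `dΨᵢ(Λᵢ V_{Mᵢ,aᵢ})` eventually
future-directed on every truncated slab and `dΦ(∂₀)` eventually future-directed on the flat slabs
(curried, in this order) — there is a `C²` `FinalStateDecomposition d` of THIS `O'` with `d.N = N`,
`d.mass = M`, `d.spin = a`, `O' = exteriorOf 𝒟 d.charted`, `HasExhaustiveCharts d` (radii `Rᵢ`) and
`IsFutureOriented d`.
Bookkeeping only: near-zone convergence at a fixed radius `r` follows from convergence out to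
`Rᵢ(τ) ≥ r` eventually (`truncDeviationCk` is monotone in the radius), and the decomposition's global
covering clause at `τ₀` is the certified covering at `τ₁ = τ₀` pushed through the monotonicity of `J⁻`
(truncated slabs lie in full slabs, certified late pieces in late pieces). Dafermos–Luk arXiv:1710.01722,
Conjecture 1 (b)–(c) (shape); O'Neill 1983, Ch. 14, p. 403. [folklore] -/
theorem decomposition_of_lateCharts : ∀ {X : Type} [TopologicalSpace X] [ChartedSpace E3 X] [IsManifold (𝓡 3) ((⊤ : ℕ∞) : WithTop ℕ∞) X] [ConnectedSpace X] {D : InitialDataSet (𝓡 3) X} (𝒟 : CauchyDevelopment D) (N : ℕ) (M a : Fin N → ℝ), (∀ j, 0 < M j) → (∀ j, |a j| ≤ M j) → ∀ (O' : Set 𝒟.carrier) (mo : Fin N → lorentzGroup × E4) (τ₀ : ℝ) (Ψ : ∀ i, boostedKerrExterior (mo i).1 (mo i).2 (M i) (a i) → 𝒟.carrier) (ρ : Fin N → ℝ → ℝ) (U₀ : TopologicalSpace.Opens E4) (Φ : U₀ → 𝒟.carrier) (R : Fin N → ℝ → ℝ), O' = Summit.FinalStateConjecture.exteriorOf 𝒟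 (Φ '' (Minkowski.backgroundOn U₀).lateRegion τ₀ ∪ ⋃ i, Ψ i '' (boostedKerrBackground (mo i).1 (mo i).2 (M i) (a i)).lateRegion τ₀) → (∀ i, 𝒟.toSpacetime.IsLateChart (boostedKerrBackground (mo i).1 (mo i).2 (M i) (a i)) O' τ₀ (Ψ i)) → (∀ r : ℝ, ∃ τ₁ : ℝ, Pairwise (Function.onFun Disjoint fun i ↦ Ψ i '' (boostedKerrBackground (mo i).1 (mo i).2 (M i) (a i)).truncLateRegion τ₁ r)) → (∀ i, Tendsto (fun t ↦ ρ i t / t) atTop (𝓝 0)) → {x : E4 | τ₀ < x 0 ∧ ∀ i, ρ i (x 0) < Kerr.radius (a i) (poincareInv (mo i).1 (mo i).2 x)} ⊆ (U₀ : Set E4) → 𝒟.toSpacetime.IsLateChart (Minkowski.backgroundOn U₀) O' τ₀ Φ → Tendsto (fun τ ↦ 𝒟.toSpacetime.deviationCk (Minkowski.backgroundOn U₀) Φ 2 τ) atTop (𝓝 0) → (∀ i, Tendsto (R i) atTop atTop ∧ ∀ τ, max (Kerr.rPlus (M i) (a i)) 0 + 1 ≤ R i τ) → (∀ i, Tendsto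 (fun τ ↦ 𝒟.toSpacetime.truncDeviationCk (boostedKerrBackground (mo i).1 (mo i).2 (M i) (a i)) (Ψ i) 2 (R i τ) τ) atTop (𝓝 0)) → (∀ τ₁ : ℝ, τ₀ ≤ τ₁ → O' \ (Φ '' (Minkowski.backgroundOn U₀).lateRegion τ₁ ∪ ⋃ i, Ψ i '' {x | τ₁ < (boostedKerrBackground (mo i).1 (mo i).2 (M i) (a i)).time x.1 ∧ (boostedKerrBackground (mo i).1 (mo i).2 (M i) (a i)).radius x.1 ≤ R i ((boostedKerrBackground (mo i).1 (mo i).2 (M i) (a i)).time x.1)}) ⊆ 𝒟.metric.causalPast 𝒟.timeOrientation (Φ '' (Minkowski.backgroundOn U₀).timeSlab τ₁ ∪ ⋃ i, Ψ i '' (boostedKerrBackground (mo i).1 (mo i).2 (M i) (a i)).truncTimeSlab (R i τ₁) τ₁)) → (∀ i, Summit.FinalStateConjecture.IsOrthochronous (mo i).1) → (∀ i (r : ℝ), ∀ᶠ τ in atTop, ∀ x ∈ (boostedKerrBackground (mo i).1 (mo i).2 (M i) (a i)).truncTimeSlab r τ, 𝒟.toSpacetime.timeOrientation.IsFutureDirected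 (mfderiv 𝓘(ℝ, E4) (𝓡 4) (Ψ i) x (((mo i).1 : E4 ≃L[ℝ] E4) (Kerr.timeVector (M i) (a i) (poincareInv (mo i).1 (mo i).2 (x : E4)))))) → (∀ᶠ τ in atTop, ∀ x ∈ (Minkowski.backgroundOn U₀).timeSlab τ, 𝒟.toSpacetime.timeOrientation.IsFutureDirected (mfderiv 𝓘(ℝ, E4) (𝓡 4) Φ x (E4.basisVector 0))) → ∃ d : FinalStateDecomposition 𝒟.toSpacetime O' 2, d.N = N ∧ (∀ (i : Fin d.N) (j : Fin N), (i : ℕ) = (j : ℕ) → d.mass i = M j ∧ d.spin i = a j) ∧ O' = Summit.FinalStateConjecture.exteriorOf 𝒟 d.charted ∧ Summit.FinalStateConjecture.HasExhaustiveCharts d ∧ Summit.FinalStateConjecture.IsFutureOriented d := by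
  intro X _ _ _ _ D 𝒟 N M a hM ha O' mo τ₀ Ψ ρ U₀ Φ R hO' hlate hsep hexc hdom hflat hdev hR htrunc hcov
    horth hfutK hfutF
  -- near-zone convergence at every FIXED radius `r`, from convergence out to `R i τ → ∞`
  have htruncFix : ∀ (i : Fin N) (r : ℝ), Tendsto (fun τ ↦ 𝒟.toSpacetime.truncDeviationCk
      (boostedKerrBackground (mo i).1 (mo i).2 (M i) (a i)) (Ψ i) 2 r τ) atTop (𝓝 0) := by
    intro i r
    refine tendsto_of_tendsto_of_tendsto_of_le_of_le' tendsto_const_nhds (htrunc i)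
      (Eventually.of_forall fun _ ↦ zero_le) ?_
    filter_upwards [(hR i).1.eventually_ge_atTop r] with τ hτ
    exact 𝒟.toSpacetime.truncDeviationCk_mono _ _ 2 hτ τ
  let d : FinalStateDecomposition 𝒟.toSpacetime O' 2 :=
    { N := N
      mass := M
      spin := a
      mass_pos := hM
      abs_spin_le_mass := ha
      motion := mo
      τ₀ := τ₀
      chart := Ψ
      isLateChart := hlate
      tendsto_truncDeviationCk := htruncFix
      exists_pairwise_disjoint := hsep
      excision := ρ
      tendsto_excision_div := hexc
      flatDomain := U₀
      setOf_lt_excision_subset_flatDomain := hdom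
      flatChart := Φ
      isLateChart_flat := hflat
      tendsto_deviationCk_flat := hdev
      diff_subset_causalPast := by
        -- the certified covering at `τ₁ = τ₀`, pushed through the monotonicity of `J⁻`
        rintro p ⟨hpO, hpn⟩
        refine LorentzianMetric.causalFuture_mono ?_ (hcov τ₀ le_rfl ⟨hpO, ?_⟩)
        · rintro q (hq | hq)
          · exact Or.inr hq
          · obtain ⟨i, x, hx, rfl⟩ := Set.mem_iUnion.1 hq
            exact Or.inl (Set.mem_iUnion.2 ⟨i, x, hx.1, rfl⟩)
        · rintro (hq | hq)
          · exact hpn (Or.inr hq)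
          · obtain ⟨i, x, hx, rfl⟩ := Set.mem_iUnion.1 hq
            exact hpn (Or.inl (Set.mem_iUnion.2 ⟨i, x, hx.1, rfl⟩)) }
  refine ⟨d, rfl, ?_, hO', ⟨R, hR, htrunc, fun τ₁ hτ₁ ↦ hcov τ₁ hτ₁.le⟩, ⟨horth, hfutK, hfutF⟩⟩
  -- the labels are `(M, a)` definitionally
  rintro ⟨i, hi⟩ ⟨j, hj⟩ h
  simp only at h
  subst h
  exact ⟨rfl, rfl⟩

/-- **ASSEMBLE on the live multi-hole range = GLUING + packaging.** The registered stub
`stub_globalGaugePos` (verbatim, the conclusion: `0 < N`, `0 < m₀ ≤ 1`, `0 ≤ χ < 1`, an MGHD `𝒟` of an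
admissible datum with complete `𝓘⁺`, a point `(M, a, Λ)` of the moduli box `Mⱼ ∈ [m₀, m₀⁻¹]`,
`|aⱼ| ≤ χ Mⱼ`, all-accuracy tracking pinned at `(M, a, Λ)` within every `δ > 0` ⇒ a `C²`
`FinalStateDecomposition d` with `d.N = N`, labels `(M, a)`, `O' = exteriorOf 𝒟 d.charted`,
`HasExhaustiveCharts d`, `IsFutureOriented d`) follows from the GLUING statement (the hypothesis: under
the same binders and the same pinned-tracking hypothesis, the window charts patch into the late-chart
data of `decomposition_of_lateCharts` — a region `O'`, motions, a late time, `N` hole charts on the boosted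
Kerr exteriors `(Mⱼ, aⱼ, Λⱼ', cⱼ)`, sublinear excision radii, a flat chart, honest growing near-zone radii,
with `O'` the exterior of the charted set, late charts into `O'`, separation, `C²` convergence on flat
slabs and on truncated slabs out to the radii, certified causal covering at every chart time `≥ τ₀`,
orthochronous motions and eventually future-directed pushed-forward time vectors). The labels are
positive and (non-strictly) sub-extremal by the box: `0 < m₀ ≤ Mⱼ`, `|aⱼ| ≤ χ Mⱼ ≤ Mⱼ` (`χ < 1`).
Dafermos–Luk arXiv:1710.01722, Conjecture 1 (b)–(c); Klainerman, C. R. Mécanique 353 (2025), §2.3.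
[folklore] -/
theorem globalGaugePos_of_lateCharts : (∀ (N : ℕ) (m₀ χ : ℝ), 0 < N → m₀ ≤ 1 → 0 < m₀ → 0 ≤ χ → χ < 1 → ∀ (X : Type) [TopologicalSpace X] [ChartedSpace E3 X] [IsManifold (𝓡 3) ((⊤ : ℕ∞) : WithTop ℕ∞) X] [T2Space X] [SecondCountableTopology X] [ConnectedSpace X], ∀ D ∈ admissibleVacuumData X, ∀ 𝒟 : VacuumCauchyDevelopment D, 𝒟.IsMaximal → Summit.FinalStateConjecture.HasCompleteNullInfinity 𝒟.toCauchyDevelopment → ∀ (M a : Fin N → ℝ) (Λ : Fin N → lorentzGroup), (∀ j, m₀ ≤ M j ∧ M j ≤ m₀⁻¹ ∧ |a j| ≤ χ * M j) → (∀ δ : ℝ, 0 < δ → ∀ (L : ℝ) (ε : ENNReal) (R₀ : ℝ), 0 < L → 0 < ε → ∃ (R : ℕ → ℝ) (O : Set 𝒟.carrier) (c : ∀ n : ℕ, ApproximateKerrConfiguration 𝒟.toSpacetime O 2 ε 0 L (R n)), (∀ n, R₀ ≤ R n) ∧ Tendsto R atTop atTop ∧ (∀ n, (c n).N = N) ∧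 (∀ n (i : Fin (c n).N), m₀ ≤ (c n).mass i ∧ (c n).mass i ≤ m₀⁻¹ ∧ |(c n).spin i| ≤ χ * (c n).mass i) ∧ (∀ n (i : Fin (c n).N) (j : Fin N), (i : ℕ) = (j : ℕ) → |(c n).mass i - M j| ≤ δ ∧ |(c n).spin i - a j| ≤ δ ∧ ‖((((c n).motion i).1 : E4 ≃L[ℝ] E4) : E4 →L[ℝ] E4) - (((Λ j : E4 ≃L[ℝ] E4)) : E4 →L[ℝ] E4)‖ ≤ δ) ∧ (∀ n, (c (n + 1)).certifiedSlab 0 ⊆ (c n).windowImage) ∧ (∀ K : Set 𝒟.carrier, IsCompact K → ∃ n₀ : ℕ, ∀ n, n₀ ≤ n → Disjoint (c n).windowImage (𝒟.metric.causalPast 𝒟.timeOrientation K)) ∧ O = 𝒟.toCauchyDevelopment.exteriorOf (⋃ n, (c n).windowImage) ∧ O ⊆ 𝒟.metric.causalPast 𝒟.timeOrientation ((c 0).certifiedSlab 0) ∪ ⋃ n, (c n).windowImage) → ∃ (O' : Set 𝒟.carrier) (mo : Fin N → lorentzGroup × E4) (τ₀ : ℝ) (Ψ : ∀ i, boostedKerrExterior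 (mo i).1 (mo i).2 (M i) (a i) → 𝒟.carrier) (ρ : Fin N → ℝ → ℝ) (U₀ : TopologicalSpace.Opens E4) (Φ : U₀ → 𝒟.carrier) (R : Fin N → ℝ → ℝ), O' = Summit.FinalStateConjecture.exteriorOf 𝒟.toCauchyDevelopment (Φ '' (Minkowski.backgroundOn U₀).lateRegion τ₀ ∪ ⋃ i, Ψ i '' (boostedKerrBackground (mo i).1 (mo i).2 (M i) (a i)).lateRegion τ₀) ∧ (∀ i, 𝒟.toSpacetime.IsLateChart (boostedKerrBackground (mo i).1 (mo i).2 (M i) (a i)) O' τ₀ (Ψ i)) ∧ (∀ r : ℝ, ∃ τ₁ : ℝ, Pairwise (Function.onFun Disjoint fun i ↦ Ψ i '' (boostedKerrBackground (mo i).1 (mo i).2 (M i) (a i)).truncLateRegion τ₁ r)) ∧ (∀ i, Tendsto (fun t ↦ ρ i t / t) atTop (𝓝 0)) ∧ {x : E4 | τ₀ < x 0 ∧ ∀ i, ρ i (x 0) < Kerr.radius (a i) (poincareInv (mo i).1 (mo i).2 x)} ⊆ (U₀ : Set E4) ∧ 𝒟.toSpacetime.IsLateChart (Minkowski.backgroundOn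 U₀) O' τ₀ Φ ∧ Tendsto (fun τ ↦ 𝒟.toSpacetime.deviationCk (Minkowski.backgroundOn U₀) Φ 2 τ) atTop (𝓝 0) ∧ (∀ i, Tendsto (R i) atTop atTop ∧ ∀ τ, max (Kerr.rPlus (M i) (a i)) 0 + 1 ≤ R i τ) ∧ (∀ i, Tendsto (fun τ ↦ 𝒟.toSpacetime.truncDeviationCk (boostedKerrBackground (mo i).1 (mo i).2 (M i) (a i)) (Ψ i) 2 (R i τ) τ) atTop (𝓝 0)) ∧ (∀ τ₁ : ℝ, τ₀ ≤ τ₁ → O' \ (Φ '' (Minkowski.backgroundOn U₀).lateRegion τ₁ ∪ ⋃ i, Ψ i '' {x | τ₁ < (boostedKerrBackground (mo i).1 (mo i).2 (M i) (a i)).time x.1 ∧ (boostedKerrBackground (mo i).1 (mo i).2 (M i) (a i)).radius x.1 ≤ R i ((boostedKerrBackground (mo i).1 (mo i).2 (M i) (a i)).time x.1)}) ⊆ 𝒟.metric.causalPast 𝒟.timeOrientation (Φ '' (Minkowski.backgroundOn U₀).timeSlab τ₁ ∪ ⋃ i, Ψ i '' (boostedKerrBackground (mo i).1 (mo i).2 (M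 i) (a i)).truncTimeSlab (R i τ₁) τ₁)) ∧ (∀ i, Summit.FinalStateConjecture.IsOrthochronous (mo i).1) ∧ (∀ i (r : ℝ), ∀ᶠ τ in atTop, ∀ x ∈ (boostedKerrBackground (mo i).1 (mo i).2 (M i) (a i)).truncTimeSlab r τ, 𝒟.toSpacetime.timeOrientation.IsFutureDirected (mfderiv 𝓘(ℝ, E4) (𝓡 4) (Ψ i) x (((mo i).1 : E4 ≃L[ℝ] E4) (Kerr.timeVector (M i) (a i) (poincareInv (mo i).1 (mo i).2 (x : E4)))))) ∧ ∀ᶠ τ in atTop, ∀ x ∈ (Minkowski.backgroundOn U₀).timeSlab τ, 𝒟.toSpacetime.timeOrientation.IsFutureDirected (mfderiv 𝓘(ℝ, E4) (𝓡 4) Φ x (E4.basisVector 0))) → ∀ (N : ℕ) (m₀ χ : ℝ), 0 < N → m₀ ≤ 1 → 0 < m₀ → 0 ≤ χ → χ < 1 → ∀ (X : Type) [TopologicalSpace X] [ChartedSpace E3 X] [IsManifold (𝓡 3) ((⊤ : ℕ∞) : WithTop ℕ∞) X] [T2Space X] [SecondCountableTopology X] [ConnectedSpace X], ∀ D ∈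 admissibleVacuumData X, ∀ 𝒟 : VacuumCauchyDevelopment D, 𝒟.IsMaximal → Summit.FinalStateConjecture.HasCompleteNullInfinity 𝒟.toCauchyDevelopment → ∀ (M a : Fin N → ℝ) (Λ : Fin N → lorentzGroup), (∀ j, m₀ ≤ M j ∧ M j ≤ m₀⁻¹ ∧ |a j| ≤ χ * M j) → (∀ δ : ℝ, 0 < δ → ∀ (L : ℝ) (ε : ENNReal) (R₀ : ℝ), 0 < L → 0 < ε → ∃ (R : ℕ → ℝ) (O : Set 𝒟.carrier) (c : ∀ n : ℕ, ApproximateKerrConfiguration 𝒟.toSpacetime O 2 ε 0 L (R n)), (∀ n, R₀ ≤ R n) ∧ Tendsto R atTop atTop ∧ (∀ n, (c n).N = N) ∧ (∀ n (i : Fin (c n).N), m₀ ≤ (c n).mass i ∧ (c n).mass i ≤ m₀⁻¹ ∧ |(c n).spin i| ≤ χ * (c n).mass i) ∧ (∀ n (i : Fin (c n).N) (j : Fin N), (i : ℕ) = (j : ℕ) → |(c n).mass i - M j| ≤ δ ∧ |(c n).spin i - a j| ≤ δ ∧ ‖((((c n).motion i).1 : E4 ≃L[ℝ] E4) : E4 →L[ℝ]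 E4) - (((Λ j : E4 ≃L[ℝ] E4)) : E4 →L[ℝ] E4)‖ ≤ δ) ∧ (∀ n, (c (n + 1)).certifiedSlab 0 ⊆ (c n).windowImage) ∧ (∀ K : Set 𝒟.carrier, IsCompact K → ∃ n₀ : ℕ, ∀ n, n₀ ≤ n → Disjoint (c n).windowImage (𝒟.metric.causalPast 𝒟.timeOrientation K)) ∧ O = 𝒟.toCauchyDevelopment.exteriorOf (⋃ n, (c n).windowImage) ∧ O ⊆ 𝒟.metric.causalPast 𝒟.timeOrientation ((c 0).certifiedSlab 0) ∪ ⋃ n, (c n).windowImage) → ∃ (O' : Set 𝒟.carrier) (d : FinalStateDecomposition 𝒟.toSpacetime O' 2), d.N = N ∧ (∀ (i : Fin d.N) (j : Fin N), (i : ℕ) = (j : ℕ) → d.mass i = M j ∧ d.spin i = a j) ∧ O' = Summit.FinalStateConjecture.exteriorOf 𝒟.toCauchyDevelopment d.charted ∧ Summit.FinalStateConjecture.HasExhaustiveCharts d ∧ Summit.FinalStateConjecture.IsFutureOriented d := by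
  intro H N m₀ χ hN hm₁ hm₀ hχ₀ hχ₁ X _ _ _ _ _ _ D hD 𝒟 hmax hscri M a Λ hbox hpin
  have hMpos : ∀ j, 0 < M j := fun j ↦ hm₀.trans_le (hbox j).1
  have ha : ∀ j, |a j| ≤ M j := fun j ↦
    (hbox j).2.2.trans (mul_le_of_le_one_left (hMpos j).le hχ₁.le)
  obtain ⟨O', mo, τ₀, Ψ, ρ, U₀, Φ, R, hO', hlate, hsep, hexc, hdom, hflat, hdev, hR, htrunc, hcov,
    horth, hfutK, hfutF⟩ := H N m₀ χ hN hm₁ hm₀ hχ₀ hχ₁ X D hD 𝒟 hmax hscri M a Λ hbox hpin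
  exact ⟨O', decomposition_of_lateCharts 𝒟.toCauchyDevelopment N M a hMpos ha O' mo τ₀ Ψ ρ U₀ Φ R hO'
    hlate hsep hexc hdom hflat hdev hR htrunc hcov horth hfutK hfutF⟩

end Summit.FinalStateConjecture.FinalStateConjecture.Theorems.RenormalisedDrift.DriftCapture

end
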